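import Mathlib
import HarnessLib
import Summits.NavierStokesRegularity.NavierStokesRegularity.Theorems.PoloidalWindowDoorPoloidalWindowRigiditySeparatedShearEnergy
import Summits.NavierStokesRegularity.NavierStokesRegularity.Theorems.PoloidalWindowDoorPoloidalWindowRigidityConstantShearGronwall

/-!
# Route `PoloidalWindowDoor`, crux `PoloidalWindowRigidity` (K2, stmt-NavierStokesRegularity-19708) —
# the SEPARATED-PRESSURE stratum with non-negative Clebsch production: KEY inequality and `Ψ' ≤ (3M₀/L)Ψ + O(L/R)`

Cell ns-regularity-ideate, seat ns-poloidal-K2-p2 (stub-worker, gen 2; support lemmas `--supports` the crux,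
`--as helper`).  Extension of the constant-shear chain (`…ConstantShearVariance/Gronwall`) to K2-p1's SEPARATED-PRESSURE
stratum `∇_h f₂ ≡ 0` (`f = ∂ₜv + (v·∇)v − Δv` the intrinsic residual, `= −∇p`; hypothesis `hsep`, stated intrinsically),
with the constant-shear dissipation `(1−μ)⟨|∇_h v₂|²⟩` replaced by the CLEBSCH PRODUCTION
`Dsep = ⟨∇_h v₂·(∇_h v₂ − ∂₂v_h)⟩` (`= ⟨Λ|∇_hψ|²⟩`, `Λ` the Clebsch slope), whose pointwise non-negativity is the
hypothesis `hprod` (`Λ ≥ 0`; on the constant-shear stratum `μ < 1`):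

* `residual_vert_eq_of_height_eq_of_sep` — on the stratum `f₂(t,·)` depends on the height only;
* `sliceDsep`, `key_slice_sep` — `∂ₜV + 2∂_zG + 2Dsep ≤ (8M₀³ + 8M₀M₁)K/R` (via `…SeparatedShearEnergy.key_mean_sep`);
* `deriv_psi_le_sep` — `Ψ' ≤ (3M₀/L)Ψ + πL K(t)/R` under `hprod`.

WHAT THIS IS NOT: not a claim about Navier–Stokes regularity and not the open residue S2⁗ — one located stratum of a
door route's Type-I Liouville problem (bears_on LADDER-NS N0, rung N0-LocalTubeDoorPoloidal).
-/

noncomputable section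

-- the summit and its single sub-problem share the name (CONVENTIONS §1), as in every Theorems file
set_option linter.dupNamespace false

namespace Summit.NavierStokesRegularity.NavierStokesRegularity.Theorems.PoloidalWindowDoorPoloidalWindowRigiditySeparatedShearVariance

open MeasureTheory Set Function Filter Topology Metric InnerProductSpace
open scoped RealInnerProductSpace InnerProductSpace Laplacian ContDiff
open Literature.Analysis Literature.Analysis.FluidPDE
open Summit.NavierStokesRegularity.NavierStokesRegularity.Theorems.PoloidalWindowDoorPoloidalWindowRigidityWindow
open Summit.NavierStokesRegularity.NavierStokesRegularity.Theorems.PoloidalWindowDoorPoloidalWindowRigidityHorizontalMean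
open Summit.NavierStokesRegularity.NavierStokesRegularity.Theorems.PoloidalWindowDoorPoloidalWindowRigidityConstantShearMeans
open Summit.NavierStokesRegularity.NavierStokesRegularity.Theorems.PoloidalWindowDoorPoloidalWindowRigidityConstantShearSlice
open Summit.NavierStokesRegularity.NavierStokesRegularity.Theorems.PoloidalWindowDoorPoloidalWindowRigidityConstantShearVariance
open Summit.NavierStokesRegularity.NavierStokesRegularity.Theorems.PoloidalWindowDoorPoloidalWindowRigidityConstantShearGronwall
open Summit.NavierStokesRegularity.NavierStokesRegularity.Theorems.PoloidalWindowDoorPoloidalWindowRigiditySeparatedShearEnergy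

variable (φ : ContDiffBump (0 : EuclideanSpace ℝ (Fin 2))) (R : ℝ)
  (v : ℝ → EuclideanSpace ℝ (Fin 3) → EuclideanSpace ℝ (Fin 3))

/-- The horizontal mean of the CLEBSCH PRODUCTION `∇_h v₂·(∇_h v₂ − ∂₂v_h)` at time `t`, height `z`. -/
def sliceDsep (t z : ℝ) : ℝ :=
  hmean φ 0 R z (fun x =>
    fderiv ℝ (fun y => v t y 2) x (EuclideanSpace.single 0 (1 : ℝ)) *
      (fderiv ℝ (fun y => v t y 2) x (EuclideanSpace.single 0 (1 : ℝ)) - fderiv ℝ (v t) x (EuclideanSpace.single 2 (1 : ℝ)) 0) +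
    fderiv ℝ (fun y => v t y 2) x (EuclideanSpace.single 1 (1 : ℝ)) *
      (fderiv ℝ (fun y => v t y 2) x (EuclideanSpace.single 1 (1 : ℝ)) - fderiv ℝ (v t) x (EuclideanSpace.single 2 (1 : ℝ)) 1))

variable {φ R v} {C : ℝ}

section Class

variable (hrate : HasTypeITimeDecay C v) (hcont : ContinuousOn (uncurry v) (Iio (0 : ℝ) ×ˢ univ))
  (hmild : ∀ s t : ℝ, s < t → t < 0 → ∀ x,
    v t x = UnboundedOperators.heatExtension (v s) (t - s) x - oseenDuhamel 1 s v v t x)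
  (hdiv : ∀ t < 0, VectorCalculus.IsDivFree (v t))

include hrate hcont hmild hdiv

/-- **On the separated-pressure stratum `f₂(t,·)` is a function of `x₂` alone**: `∂₀f₂ = ∂₁f₂ = 0` (hypothesis `hsep`)
and `f(t,·) = −∇p(t,·)` is smooth (classical pressure of the window `(2t,0)`), so `f₂` is constant along horizontal
segments. -/
theorem residual_vert_eq_of_height_eq_of_sep
    (hsep : ∀ t < 0, ∀ x, ∀ b : Fin 3, b ≠ 2 →
      fderiv ℝ (fun y => timeDerivWithin (Iio 0) v t y + convect (v t) (v t) y - Δ (v t) y) x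
        (EuclideanSpace.single b 1) 2 = 0)
    {t : ℝ} (ht : t < 0) {x x' : EuclideanSpace ℝ (Fin 3)} (hxx' : x 2 = x' 2) :
    (timeDerivWithin (Iio 0) v t x + convect (v t) (v t) x - Δ (v t) x) 2 =
      (timeDerivWithin (Iio 0) v t x' + convect (v t) (v t) x' - Δ (v t) x') 2 := by
  have hA : IsTypeIAncientMild C v := isTypeIAncientMild_of_class hrate hcont hmild hdiv
  have h2t : 2 * t < 0 := by linarith
  have htS : t ∈ Ioo (2 * t) 0 := ⟨by linarith, ht⟩
  obtain ⟨p, hns⟩ := hA.exists_isClassicalNSSolutionOn_Ioo h2t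
  -- the residual on the window is `−∇p`, a smooth field
  set f : EuclideanSpace ℝ (Fin 3) → EuclideanSpace ℝ (Fin 3) :=
    fun y => timeDerivWithin (Iio 0) v t y + convect (v t) (v t) y - Δ (v t) y with hf
  have hres : f = fun y => -gradient (p t) y := by
    funext y
    have hm := hns.momentum t htS y
    have hTD : timeDerivWithin (Ioo (2 * t) 0) v t y = timeDerivWithin (Iio 0) v t y := by
      rw [timeDerivWithin_eq_deriv_of_isOpen_subset isOpen_Ioo subset_rfl htS v,
        timeDerivWithin_eq_deriv_of_isOpen_subset isOpen_Iio subset_rfl ht v]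
    simp only [hTD, one_smul, Pi.zero_apply, add_zero] at hm
    simp only [hf, hm]
    abel
  have hp : ContDiff ℝ ∞ (p t) := hns.contDiff_pressure htS
  have hfd : Differentiable ℝ f := by
    rw [hres]
    have hg : Differentiable ℝ (gradient (p t)) := by
      have h1 : ContDiff ℝ 1 (fderiv ℝ (p t)) := hp.fderiv_right (m := 1) (by norm_cast)
      have h2 : gradient (p t) = fun y => (InnerProductSpace.toDual ℝ (EuclideanSpace ℝ (Fin 3))).symm (fderiv ℝ (p t) y) := by
        funext y; rfl
      rw [h2]
      exact (InnerProductSpace.toDual ℝ (EuclideanSpace ℝ (Fin 3))).symm.differentiable.comp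
        (h1.differentiable one_ne_zero)
    exact hg.neg
  -- the scalar `F = f₂` has vanishing horizontal partial derivatives
  set F : EuclideanSpace ℝ (Fin 3) → ℝ := fun y => f y 2 with hF
  have hFd : Differentiable ℝ F := fun y => by
    have h := ((EuclideanSpace.proj (𝕜 := ℝ) (2 : Fin 3)).hasFDerivAt).comp y (hfd y).hasFDerivAt
    exact h.differentiableAt
  have hF0 : ∀ y, fderiv ℝ F y (EuclideanSpace.single 0 (1 : ℝ)) = 0 := fun y => by
    rw [hF, fderiv_coord_apply (hfd y) 2]
    exact hsep t ht y 0 (by decide)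
  have hF1 : ∀ y, fderiv ℝ F y (EuclideanSpace.single 1 (1 : ℝ)) = 0 := fun y => by
    rw [hF, fderiv_coord_apply (hfd y) 2]
    exact hsep t ht y 1 (by decide)
  -- integrate along the horizontal segment from `x` to `x'`
  set d : EuclideanSpace ℝ (Fin 3) := x' - x with hd
  have hd2 : d 2 = 0 := by rw [hd]; simp [hxx']
  set γ : ℝ → ℝ := fun s => F (x + s • d) with hγ
  have hγd : ∀ s, HasDerivAt γ 0 s := by
    intro s
    have hline : HasDerivAt (fun s : ℝ => x + s • d) d s := by
      simpa using ((hasDerivAt_id s).smul_const d).const_add x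
    have h := (hFd (x + s • d)).hasFDerivAt.comp_hasDerivAt s hline
    have hzero : fderiv ℝ F (x + s • d) d = 0 := by
      rw [fderiv_apply_eq_sum]
      simp only [Fin.sum_univ_three, hF0, hF1, hd2, mul_zero, zero_mul, add_zero]
    rw [hzero] at h
    exact h
  have hconst := is_const_of_deriv_eq_zero (fun s => (hγd s).differentiableAt) (fun s => (hγd s).deriv) 0 1
  simp only [hγ, zero_smul, add_zero, one_smul] at hconst
  have hx' : x + d = x' := by rw [hd]; abel
  rw [hx'] at hconst
  exact hconst


/-- `Dsep(t,·)` is continuous in the height and `|Dsep| ≤ 4 (C₁/(−t))²`. -/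
theorem continuous_sliceDsep_and_le {C₁ : ℝ} (hC₁ : ∀ t < 0, ∀ y, ‖fderiv ℝ (v t) y‖ ≤ C₁ / (-t)) {t : ℝ} (ht : t < 0) :
    Continuous (fun ζ => sliceDsep φ R v t ζ) ∧ ∀ z, |sliceDsep φ R v t z| ≤ 4 * (C₁ / (-t)) ^ 2 := by
  have hA : IsTypeIAncientMild C v := isTypeIAncientMild_of_class hrate hcont hmild hdiv
  have hv2 : ContDiff ℝ 2 (v t) := (hA.contDiff_slice ht).of_le (by norm_cast)
  have hud : Differentiable ℝ (v t) := hv2.differentiable (by norm_num)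
  have hθ2 : ContDiff ℝ 2 (fun y => v t y 2) := (contDiff_vert hrate hcont hmild hdiv ht).of_le (by norm_cast)
  have hΨ : ∀ b : Fin 3, ContDiff ℝ 1 (fun x => fderiv ℝ (fun y => v t y 2) x (EuclideanSpace.single b (1 : ℝ))) :=
    fun b => (hθ2.fderiv_right (m := 1) (by norm_cast)).clm_apply contDiff_const
  have hS : ∀ b : Fin 3, ContDiff ℝ 1 (fun x => fderiv ℝ (v t) x (EuclideanSpace.single 2 (1 : ℝ)) b) :=
    fun b => contDiff_one_fderiv_apply hv2 _ b
  have hF : ContDiff ℝ 1 (fun x =>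
      fderiv ℝ (fun y => v t y 2) x (EuclideanSpace.single 0 (1 : ℝ)) *
        (fderiv ℝ (fun y => v t y 2) x (EuclideanSpace.single 0 (1 : ℝ)) - fderiv ℝ (v t) x (EuclideanSpace.single 2 (1 : ℝ)) 0) +
      fderiv ℝ (fun y => v t y 2) x (EuclideanSpace.single 1 (1 : ℝ)) *
        (fderiv ℝ (fun y => v t y 2) x (EuclideanSpace.single 1 (1 : ℝ)) - fderiv ℝ (v t) x (EuclideanSpace.single 2 (1 : ℝ)) 1)) :=
    ((hΨ 0).mul ((hΨ 0).sub (hS 0))).add ((hΨ 1).mul ((hΨ 1).sub (hS 1)))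
  refine ⟨continuous_hmean_height (φ := φ) (R := R) 0 hF, fun z => ?_⟩
  have hb : ∀ (b : Fin 3) x, |fderiv ℝ (fun y => v t y 2) x (EuclideanSpace.single b (1 : ℝ))| ≤ C₁ / (-t) := fun b x => by
    rw [fderiv_coord_apply (hud x) 2]; exact abs_fderiv_single_le (hC₁ t ht) x b 2
  have hs : ∀ (b : Fin 3) x, |fderiv ℝ (v t) x (EuclideanSpace.single 2 (1 : ℝ)) b| ≤ C₁ / (-t) := fun b x =>
    abs_fderiv_single_le (hC₁ t ht) x 2 b
  have hM : 0 ≤ C₁ / (-t) := (abs_nonneg _).trans (hb 0 0)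
  refine abs_hmean_le φ 0 R z hF.continuous fun x => ?_
  have e : ∀ b : Fin 3, |fderiv ℝ (fun y => v t y 2) x (EuclideanSpace.single b (1 : ℝ)) *
      (fderiv ℝ (fun y => v t y 2) x (EuclideanSpace.single b (1 : ℝ)) - fderiv ℝ (v t) x (EuclideanSpace.single 2 (1 : ℝ)) b)| ≤
      2 * (C₁ / (-t)) ^ 2 := fun b => by
    rw [abs_mul]
    calc _ ≤ (C₁ / (-t)) * (C₁ / (-t) + C₁ / (-t)) :=
          mul_le_mul (hb b x) ((abs_sub _ _).trans (add_le_add (hb b x) (hs b x))) (abs_nonneg _) hM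
      _ = 2 * (C₁ / (-t)) ^ 2 := by ring
  calc _ ≤ _ := abs_add_le _ _
    _ ≤ 2 * (C₁ / (-t)) ^ 2 + 2 * (C₁ / (-t)) ^ 2 := add_le_add (e 0) (e 1)
    _ = 4 * (C₁ / (-t)) ^ 2 := by ring

/-- **KEY INEQUALITY ON THE SEPARATED-PRESSURE STRATUM**: for a profile of the class with `∇_h f₂ ≡ 0` on every slice
and gradient rate `C₁`: `∂ₜV + 2∂_zG + 2Dsep ≤ R⁻¹(8M₀³ + 8M₀M₁)(‖∂₀φ̄‖₁+‖∂₁φ̄‖₁)`, `M₀ = C/√(−t)`, `M₁ = C₁/(−t)`. -/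
theorem key_slice_sep (hsep : ∀ t < 0, ∀ x, ∀ b : Fin 3, b ≠ 2 →
      fderiv ℝ (fun y => timeDerivWithin (Iio 0) v t y + convect (v t) (v t) y - Δ (v t) y) x
        (EuclideanSpace.single b 1) 2 = 0)
    {C₁ : ℝ} (hC₁ : ∀ t < 0, ∀ y, ‖fderiv ℝ (v t) y‖ ≤ C₁ / (-t)) (hR : 0 < R) {t : ℝ} (ht : t < 0) (z : ℝ) :
    sliceVt φ R v t z + 2 * sliceGz φ R v t z + 2 * sliceDsep φ R v t z ≤
      R⁻¹ * (8 * (C / Real.sqrt (-t) * (C / Real.sqrt (-t)) * (C / Real.sqrt (-t))) +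
        8 * (C / Real.sqrt (-t) * (C₁ / (-t)))) * bumpK φ := by
  have hA : IsTypeIAncientMild C v := isTypeIAncientMild_of_class hrate hcont hmild hdiv
  have hu : ContDiff ℝ 2 (v t) := (hA.contDiff_slice ht).of_le (by norm_cast)
  have hdiv' := fun x => div_coord (hdiv t ht) x
  have hθt := (contDiff_vertT hrate hcont hmild hdiv ht).continuous
  set g : ℝ → ℝ := fun ζ => (timeDerivWithin (Iio 0) v t (ζ • EuclideanSpace.single 2 (1 : ℝ)) +
    convect (v t) (v t) (ζ • EuclideanSpace.single 2 (1 : ℝ)) - Δ (v t) (ζ • EuclideanSpace.single 2 (1 : ℝ))) 2 with hg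
  have heq : ∀ x, deriv (fun s => v s x) t 2 + fderiv ℝ (fun y => v t y 2) x (v t x) -
      ∑ i : Fin 3, fderiv ℝ (fun y => fderiv ℝ (fun y' => v t y' 2) y (EuclideanSpace.single i (1 : ℝ))) x
        (EuclideanSpace.single i (1 : ℝ)) = g (x 2) := by
    intro x
    rw [← (hasDerivAt_vert hrate hcont hmild hdiv ht x).deriv, vertical_equation_coord hrate hcont hmild hdiv ht x, hg]
    exact residual_vert_eq_of_height_eq_of_sep hrate hcont hmild hdiv hsep ht (by simp)
  have key := key_mean_sep φ 0 z hu hdiv' (fun x => hrate t ht x) (hC₁ t ht) hθt heq hR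
  unfold sliceVt sliceGz sliceDsep sliceM sliceE
  exact key

/-- **`Ψ' ≤ (3M₀/L)Ψ + πL·K(t)/R`** on the separated-pressure stratum with non-negative Clebsch production. -/
theorem deriv_psi_le_sep (hsep : ∀ t < 0, ∀ x, ∀ b : Fin 3, b ≠ 2 →
      fderiv ℝ (fun y => timeDerivWithin (Iio 0) v t y + convect (v t) (v t) y - Δ (v t) y) x
        (EuclideanSpace.single b 1) 2 = 0)
    (hprod : ∀ t < 0, ∀ x,
      0 ≤ fderiv ℝ (fun y => v t y 2) x (EuclideanSpace.single 0 (1 : ℝ)) *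
            (fderiv ℝ (fun y => v t y 2) x (EuclideanSpace.single 0 (1 : ℝ)) - fderiv ℝ (v t) x (EuclideanSpace.single 2 (1 : ℝ)) 0) +
          fderiv ℝ (fun y => v t y 2) x (EuclideanSpace.single 1 (1 : ℝ)) *
            (fderiv ℝ (fun y => v t y 2) x (EuclideanSpace.single 1 (1 : ℝ)) - fderiv ℝ (v t) x (EuclideanSpace.single 2 (1 : ℝ)) 1))
    {C₁ : ℝ} (hC₁ : ∀ t < 0, ∀ y, ‖fderiv ℝ (v t) y‖ ≤ C₁ / (-t)) (hR : 0 < R) {L : ℝ} (hL : 0 < L)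
    {t : ℝ} (ht : t < 0) :
    ∫ z, sliceVt φ R v t z * wgt L z ≤
      3 * (C / Real.sqrt (-t)) / L * psi φ R v L t +
        R⁻¹ * (8 * (C / Real.sqrt (-t) * (C / Real.sqrt (-t)) * (C / Real.sqrt (-t))) +
          8 * (C / Real.sqrt (-t) * (C₁ / (-t)))) * bumpK φ * (Real.pi * L) := by
  obtain ⟨cV, cVt, cG, cGz⟩ := continuous_slices (φ := φ) (R := R) hrate hcont hmild hdiv ht
  set M₀ := C / Real.sqrt (-t) with hM₀
  set Kt := R⁻¹ * (8 * (M₀ * M₀ * M₀) + 8 * (M₀ * (C₁ / (-t)))) * bumpK φ with hKt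
  have hM₀0 : 0 ≤ M₀ := (norm_nonneg _).trans (hrate t ht 0)
  -- integrability of the pieces against the weight
  have iVt : Integrable fun z => sliceVt φ R v t z * wgt L z := by
    obtain ⟨C₄, hC₄⟩ := Summit.NavierStokesRegularity.NavierStokesRegularity.Theorems.PoloidalWindowDoorPoloidalWindowRigidityConstantShearSlice.exists_timeDeriv_rate_of_class
      hrate hcont hmild
    refine integrable_of_abs_le_mul_wgt hL.ne' (cVt.mul (continuous_wgt L))
      (B := 4 * (C / Real.sqrt (-t)) * (C₄ / ((-t) * Real.sqrt (-t)))) fun z => ?_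
    rw [abs_mul, abs_of_pos (wgt_pos L z)]
    exact mul_le_mul_of_nonneg_right (abs_sliceVt_le hrate hcont hmild hdiv hC₄ ht z) (wgt_pos L z).le
  have iGz : Integrable fun z => sliceGz φ R v t z * wgt L z := by
    refine integrable_of_abs_le_mul_wgt hL.ne' (cGz.mul (continuous_wgt L))
      (B := 6 * (C / Real.sqrt (-t)) ^ 2 * (C₁ / (-t))) fun z => ?_
    rw [abs_mul, abs_of_pos (wgt_pos L z)]
    exact mul_le_mul_of_nonneg_right (abs_sliceGz_le hrate hcont hmild hdiv hC₁ ht z) (wgt_pos L z).le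
  obtain ⟨cD, hDb⟩ := continuous_sliceDsep_and_le (φ := φ) (R := R) hrate hcont hmild hdiv hC₁ ht
  have hD0 : ∀ z, 0 ≤ sliceDsep φ R v t z := fun z => hmean_nonneg φ 0 R z fun x => hprod t ht x
  have iD : Integrable fun z => sliceDsep φ R v t z * wgt L z := by
    refine integrable_of_abs_le_mul_wgt hL.ne' (cD.mul (continuous_wgt L)) (B := 4 * (C₁ / (-t)) ^ 2) fun z => ?_
    rw [abs_mul, abs_of_pos (wgt_pos L z)]
    exact mul_le_mul_of_nonneg_right (hDb z) (wgt_pos L z).le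
  have iG : Integrable fun z => sliceG φ R v t z * wgt L z := by
    refine integrable_of_abs_le_mul_wgt hL.ne' (cG.mul (continuous_wgt L)) (B := 3 / 2 * M₀ * (C ^ 2 / (-t))) fun z => ?_
    rw [abs_mul, abs_of_pos (wgt_pos L z)]
    refine mul_le_mul_of_nonneg_right ((abs_sliceG_le hrate hcont hmild hdiv ht z).trans ?_) (wgt_pos L z).le
    exact mul_le_mul_of_nonneg_left (sliceV_le hrate hcont hmild hdiv ht z) (by positivity)
  have iV : Integrable fun z => sliceV φ R v t z * wgt L z := by
    refine integrable_of_abs_le_mul_wgt hL.ne' (cV.mul (continuous_wgt L)) (B := C ^ 2 / (-t)) fun z => ?_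
    rw [abs_mul, abs_of_pos (wgt_pos L z), abs_of_nonneg (sliceV_nonneg hrate hcont hmild hdiv ht z)]
    exact mul_le_mul_of_nonneg_right (sliceV_le hrate hcont hmild hdiv ht z) (wgt_pos L z).le
  -- (1) integrate the KEY inequality against the (positive) weight
  have i12 : Integrable fun z => (-2) * (sliceGz φ R v t z * wgt L z) + (-2) * (sliceDsep φ R v t z * wgt L z) :=
    (iGz.const_mul _).add (iD.const_mul _)
  have iK : Integrable fun z => Kt * wgt L z := (integrable_wgt hL.ne').const_mul _
  have h1 : ∫ z, sliceVt φ R v t z * wgt L z ≤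
      ∫ z, ((-2) * (sliceGz φ R v t z * wgt L z) + (-2) * (sliceDsep φ R v t z * wgt L z) + Kt * wgt L z) := by
    refine integral_mono iVt (i12.add iK) fun z => ?_
    have hk := key_slice_sep (φ := φ) hrate hcont hmild hdiv hsep hC₁ hR ht z
    have hw := wgt_pos L z
    nlinarith
  rw [integral_add i12 iK, integral_add (iGz.const_mul _) (iD.const_mul _), integral_const_mul, integral_const_mul,
    integral_const_mul, integral_wgt hL] at h1
  -- (2) the dissipation term is nonpositive
  have h2 : (-2) * ∫ z, sliceDsep φ R v t z * wgt L z ≤ 0 := by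
    have hD : 0 ≤ ∫ z, sliceDsep φ R v t z * wgt L z :=
      integral_nonneg fun z => mul_nonneg (hD0 z) (wgt_pos L z).le
    nlinarith
  -- (3) one integration by parts in the height: `∫ ∂_zG wgt = −∫ G wgt'`
  have h3 : ∫ z, sliceGz φ R v t z * wgt L z =
      -∫ z, sliceG φ R v t z * (-(2 * (z / L) * L⁻¹) / (1 + (z / L) ^ 2) ^ 2) := by
    have hG' : ∀ z, fderiv ℝ (fun ζ => sliceG φ R v t ζ) z 1 = sliceGz φ R v t z := fun z => by
      rw [fderiv_apply_one_eq_deriv, (hasDerivAt_sliceG hrate hcont hmild hdiv ht z).deriv]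
    have hw' : ∀ z, fderiv ℝ (wgt L) z 1 = -(2 * (z / L) * L⁻¹) / (1 + (z / L) ^ 2) ^ 2 := fun z => by
      rw [fderiv_apply_one_eq_deriv, (hasDerivAt_wgt L z).deriv]
    have hibp := integral_mul_fderiv_eq_neg_fderiv_mul_of_integrable (μ := (volume : Measure ℝ))
      (f := fun ζ => sliceG φ R v t ζ) (g := wgt L) (v := (1 : ℝ)) ?_ ?_ ?_ ?_ ?_
    · simp only [hG', hw'] at hibp
      rw [hibp, neg_neg]
    · simp only [hG']; exact iGz
    · simp only [hw']
      refine integrable_of_abs_le_mul_wgt hL.ne' (cG.mul (continuous_deriv_wgt L))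
        (B := 3 / 2 * M₀ * (C ^ 2 / (-t)) / L) fun z => ?_
      rw [abs_mul]
      calc |sliceG φ R v t z| * |-(2 * (z / L) * L⁻¹) / (1 + (z / L) ^ 2) ^ 2|
          ≤ (3 / 2 * M₀ * sliceV φ R v t z) * (wgt L z / L) :=
            mul_le_mul (abs_sliceG_le hrate hcont hmild hdiv ht z) (abs_deriv_wgt_le hL z) (abs_nonneg _)
              (by have := sliceV_nonneg (φ := φ) (R := R) hrate hcont hmild hdiv ht z; positivity)
        _ ≤ (3 / 2 * M₀ * (C ^ 2 / (-t))) * (wgt L z / L) :=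
            mul_le_mul_of_nonneg_right (mul_le_mul_of_nonneg_left (sliceV_le hrate hcont hmild hdiv ht z)
              (by positivity)) (div_nonneg (wgt_pos L z).le hL.le)
        _ = _ := by ring
    · exact iG
    · exact fun z _ => (hasDerivAt_sliceG hrate hcont hmild hdiv ht z).differentiableAt
    · exact fun z _ => (hasDerivAt_wgt L z).differentiableAt
  -- (4) `|∫ G wgt'| ≤ (3M₀/(2L)) Ψ`
  have h4 : |∫ z, sliceG φ R v t z * (-(2 * (z / L) * L⁻¹) / (1 + (z / L) ^ 2) ^ 2)| ≤
      3 / 2 * M₀ / L * psi φ R v L t := by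
    unfold psi
    rw [← integral_const_mul]
    refine (abs_integral_le_integral_abs).trans (integral_mono_of_nonneg (Eventually.of_forall fun z => abs_nonneg _)
      (iV.const_mul _) (Eventually.of_forall fun z => ?_))
    dsimp only
    rw [abs_mul]
    calc |sliceG φ R v t z| * |-(2 * (z / L) * L⁻¹) / (1 + (z / L) ^ 2) ^ 2|
        ≤ (3 / 2 * M₀ * sliceV φ R v t z) * (wgt L z / L) :=
          mul_le_mul (abs_sliceG_le hrate hcont hmild hdiv ht z) (abs_deriv_wgt_le hL z) (abs_nonneg _)
            (by have := sliceV_nonneg (φ := φ) (R := R) hrate hcont hmild hdiv ht z; positivity)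
      _ = 3 / 2 * M₀ / L * (sliceV φ R v t z * wgt L z) := by ring
  -- assemble
  have h5 : (-2) * ∫ z, sliceGz φ R v t z * wgt L z ≤ 3 * M₀ / L * psi φ R v L t := by
    rw [h3]
    set I := ∫ z, sliceG φ R v t z * (-(2 * (z / L) * L⁻¹) / (1 + (z / L) ^ 2) ^ 2) with hI
    have hI2 := (abs_le.1 h4).2
    have e1 : (-2 : ℝ) * -I = 2 * I := by ring
    have e2 : 3 * M₀ / L * psi φ R v L t = 2 * (3 / 2 * M₀ / L * psi φ R v L t) := by ring
    rw [e1, e2]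
    exact mul_le_mul_of_nonneg_left hI2 zero_le_two
  linarith [h1, h2, h5]

end Class

end Summit.NavierStokesRegularity.NavierStokesRegularity.Theorems.PoloidalWindowDoorPoloidalWindowRigiditySeparatedShearVariance

end
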